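import Summits.QuantumFields.BalabanUV.Beta.EriceFlowEnclosureB12AsPrintedHistoryContagionShiftFlowZeroSemigroupBackward
import Summits.QuantumFields.BalabanUV.Beta.EriceFlowEnclosureB12AsPrintedHistoryContagionShiftFlowZeroSemigroupOneLoop
import Mathlib.Analysis.Calculus.Monotone
import Mathlib.Analysis.Calculus.Deriv.Inverse

/-!
# Beta / EriceFlowEnclosureB12AsPrintedHistoryContagionShiftFlowZeroSemigroupVelocity — ASYMPTOTIC FREEDOM IS CONTAGIOUS, part 55: THE Λ-COORDINATE AND THE CONTINUOUS
# RENORMALIZATION GROUP ARE DIFFERENTIABLE AT ALMOST EVERY COUPLING ∕ SCALE, with NO differentiability hypothesis on the functional.  Part 46's continuous RG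
# `φ_s g = Λ⁻¹(Λ g + sβ₀)` is continuous and (3∕2)β₀-Lipschitz in the chart (part 51) but was given no velocity: a derivative hypothesis on B is typed nowhere.  Here
# (ABSTRACT: Λ strictly antitone on ]0, e′] onto `[Λ e′, ∞[` with part 35's chart bounds `(2∕3)Δ ≤ Λ e₁ − Λ e₂ ≤ (4∕3)Δ`, `Δ = 1∕e₁² − 1∕e₂²`): (§86) by LEBESGUE's theorem
# on monotone functions, Λ is differentiable at ALMOST EVERY coupling of ]0, e′[ (**`ae_differentiableAt_abel`**), its inverse `Λ⁻¹ = invFunOn Λ (Ioc 0 e′)` at almost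
# every value (`ae_differentiableAt_abelInv`), and for every coupling g the running coupling `s ↦ φ_s g` at ALMOST EVERY scale (**`ae_differentiableAt_rg`**); a generic
# slope lemma (**`hasDerivAt_chart_bounds_left`**: one-sided chart bounds `c₁Δ ≤ Λ y − Λ x ≤ c₂Δ` on the left of x force `−2c₂∕x³ ≤ Λ′(x) ≤ −2c₁∕x³` wherever the
# derivative exists — the tool by which part 57 reads part 44's isometry infinitesimally); (§87) Λ is continuous at interior couplings (`abel_continuousAt`), wherever Λ
# has a derivative D at an interior coupling x it obeys **`−8∕(3x³) ≤ D ≤ −4∕(3x³)`**, in particular `D < 0` (**`hasDerivAt_abel_bounds`**), the inverse is continuous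
# above `Λ e′` (`abelInv_continuousAt`, part 51's continuity in the scale) and is differentiable where Λ is, with the reciprocal derivative (**`hasDerivAt_abelInv`**,
# Mathlib's derivative of a left inverse).  Part 56 turns these into the Gell-Mann–Low equation `∂_s φ_s g = β₀∕Λ′(φ_s g)` wherever it makes sense.
# Abstract in Λ (β-flow team, prover 1 = recursion ∕ upper ∕ bare-coupling ∕ uniqueness side, unit `b2b-balaban-beta-bflow-p1`, gen 41; ROW AP-I·Uc × NODE U2 — the
# infinitesimal renormalization group, over part 54 `…SemigroupBackward` (real times), part 51 `…SemigroupOneLoop` (`rg_continuousOn`), part 46 `…Semigroup`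
# (`rg_lt_rg_of_lt`), Mathlib's `MonotoneOn.ae_differentiableWithinAt_of_mem` (Lebesgue) and `HasDerivAt.of_local_left_inverse`)

HONEST FRAMING (page 1 of everything the β sub-cell writes): discharging `BetaPertH` makes Bałaban's UV stability UNCONDITIONAL — a
real constructive-QFT result; it is NOT the continuum limit and NOT the Clay problem.  HONEST DEPENDENCY (cell reorg 2026-08-19,
verbatim): «continuum YM on T⁴ ⇐ BetaPertH ∧ nine spine estimates (0/9 proved); BetaPertH ⇐ (D1) ∧ (D4) ∧ CAP+tail; G-an2-4 gates
asym, D1 and NE2/3/4.»  THIS MODULE DISCHARGES NOTHING: [folklore] real analysis (Lebesgue's differentiation theorem for monotone functions, the derivative of a left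
inverse, limits of one-sided slopes) about an ABSTRACT strictly antitone function Λ with two-sided chart bounds — the shape part 35 `…ShiftFlowZeroLambda` PROVES for the
relative Λ-parameter of the flow with memory near the zero pin; no hypothesis shape of node U2 is touched, nothing restated.  NOTHING is asserted about Bałaban's actual β;
«velocity of the RG» is OUR READING; the classical precedent for regular (differentiable) iteration groups is Szekeres 1958 ∕ Kuczma–Choczewski–Ger 1990 (cited as
precedent, nothing imported).  [I] = T. Bałaban, Commun. Math. Phys. **109** (1987) 249–301 [Balaban1987RG1]: Thm 2 (0.31) p. 259, (0.18)–(0.20) pp. 255–256, §5 p. 298 —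
context of the row only.

WHAT THIS FILE PROVES (0 sorry, 0 def): §86 `abs_deriv_ge_of_expansive`, `tendsto_slope_invSq_left`, **`hasDerivAt_chart_bounds_left`** (generic), **`ae_differentiableAt_abel`**,
`abelInv_strictAntiOn`, **`ae_differentiableAt_abelInv`**, **`ae_differentiableAt_rg`**; §87 `abel_continuousAt`, **`hasDerivAt_abel_bounds`**, `abelInv_continuousAt`,
**`hasDerivAt_abelInv`**.  NOT CLAIMED: that Λ is differentiable EVERYWHERE (false in general without a hypothesis on B — part 59 is the abstract smooth theory); anything
about Bałaban's β; `BetaPertH`; continuum; Clay.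
-/

namespace Summit.QuantumFields.BalabanUV.Beta.EriceFlowEnclosureB12AsPrintedHistoryContagionShiftFlowZeroSemigroupVelocity

open Filter Topology Set Function MeasureTheory
open Summit.QuantumFields.BalabanUV.Beta.EriceFlowEnclosureB12AsPrintedHistoryContagionShiftFlowZeroSemigroup (rg_mem_eq rg_lt_rg_of_lt)
open Summit.QuantumFields.BalabanUV.Beta.EriceFlowEnclosureB12AsPrintedHistoryContagionShiftFlowZeroSemigroupOneLoop (rg_continuousOn)
open Summit.QuantumFields.BalabanUV.Beta.EriceFlowEnclosureB12AsPrintedHistoryContagionShiftFlowZeroSemigroupBackward (rg_mem_eq_of_le)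

noncomputable section

/-! ## §86 Lebesgue: the Λ-coordinate, its inverse and the continuous RG are differentiable almost everywhere (abstract) -/

variable {Λ : ℝ → ℝ} {e' β₀ : ℝ}

/-- Generic: a function that EXPANDS distances near a point (`c·|y − a| ≤ |f y − f a|` on a punctured neighbourhood) has `|f′(a)| ≥ c` wherever it is differentiable.
[folklore] -/
theorem abs_deriv_ge_of_expansive {f : ℝ → ℝ} {W a c : ℝ} (hf : HasDerivAt f W a) (hexp : ∀ᶠ y in 𝓝[≠] a, c * |y - a| ≤ |f y - f a|) : c ≤ |W| := by
  have ht : Tendsto (slope f a) (𝓝[≠] a) (𝓝 W) := hasDerivAt_iff_tendsto_slope.mp hf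
  have ht' : Tendsto (fun y => |slope f a y|) (𝓝[≠] a) (𝓝 |W|) := (continuous_abs.tendsto W).comp ht
  refine ge_of_tendsto ht' ?_
  filter_upwards [hexp, self_mem_nhdsWithin] with y hy hne
  rw [slope_def_field, abs_div, le_div_iff₀ (abs_pos.2 (sub_ne_zero.2 hne))]
  exact hy

/-- Generic: the left slopes of the chart `1∕y²` at `x > 0` tend to `−2∕x³`. [folklore] -/
theorem tendsto_slope_invSq_left {x : ℝ} (hx : 0 < x) : Tendsto (slope (fun y : ℝ => 1 / y ^ 2) x) (𝓝[<] x) (𝓝 (-2 / x ^ 3)) := by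
  have hd : HasDerivAt (fun y : ℝ => 1 / y ^ 2) (-2 / x ^ 3) x := by
    have h1 := (hasDerivAt_pow 2 x).inv (pow_ne_zero 2 hx.ne')
    have h2 : HasDerivAt (fun y : ℝ => 1 / y ^ 2) (-(↑(2 : ℕ) * x ^ (2 - 1)) / (x ^ 2) ^ 2) x :=
      h1.congr_of_eventuallyEq (Eventually.of_forall fun y => by simp [one_div])
    refine h2.congr_deriv ?_
    push_cast
    field_simp
  exact (hasDerivWithinAt_iff_tendsto_slope' (show x ∉ Iio x from lt_irrefl x)).mp hd.hasDerivWithinAt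

/-- **Generic: CHART BOUNDS ON ONE SIDE BOUND THE DERIVATIVE.**  If on a left punctured neighbourhood of `x > 0`
`c₁(1∕y² − 1∕x²) ≤ Λ y − Λ x ≤ c₂(1∕y² − 1∕x²)` and Λ has derivative D at x, then **`−2c₂∕x³ ≤ D ≤ −2c₁∕x³`** (left slopes of Λ are the chart slopes times a factor in
`[c₁, c₂]`, and the chart slopes tend to `−2∕x³ < 0`). [folklore] -/
theorem hasDerivAt_chart_bounds_left {Λ : ℝ → ℝ} {x D c₁ c₂ : ℝ} (hx : 0 < x) (hD : HasDerivAt Λ D x)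
    (hratio : ∀ᶠ y in 𝓝[<] x, c₁ * (1 / y ^ 2 - 1 / x ^ 2) ≤ Λ y - Λ x ∧ Λ y - Λ x ≤ c₂ * (1 / y ^ 2 - 1 / x ^ 2)) :
    -2 * c₂ / x ^ 3 ≤ D ∧ D ≤ -2 * c₁ / x ^ 3 := by
  have hq := tendsto_slope_invSq_left hx
  have hΛ : Tendsto (slope Λ x) (𝓝[<] x) (𝓝 D) :=
    (hasDerivWithinAt_iff_tendsto_slope' (show x ∉ Iio x from lt_irrefl x)).mp hD.hasDerivWithinAt
  have hev : ∀ᶠ y in 𝓝[<] x, c₂ * slope (fun y : ℝ => 1 / y ^ 2) x y ≤ slope Λ x y ∧ slope Λ x y ≤ c₁ * slope (fun y : ℝ => 1 / y ^ 2) x y := by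
    filter_upwards [hratio, self_mem_nhdsWithin] with y hy hyx
    have hneg : y - x < 0 := by rw [mem_Iio] at hyx; linarith
    rw [slope_def_field, slope_def_field, mul_div_assoc', mul_div_assoc']
    exact ⟨div_le_div_of_nonpos_of_le hneg.le hy.2, div_le_div_of_nonpos_of_le hneg.le hy.1⟩
  constructor
  · have := le_of_tendsto_of_tendsto (hq.const_mul c₂) hΛ (hev.mono fun y hy => hy.1)
    calc -2 * c₂ / x ^ 3 = c₂ * (-2 / x ^ 3) := by ring
      _ ≤ D := this
  · have := le_of_tendsto_of_tendsto hΛ (hq.const_mul c₁) (hev.mono fun y hy => hy.2)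
    calc D ≤ c₁ * (-2 / x ^ 3) := this
      _ = -2 * c₁ / x ^ 3 := by ring

/-- **THE Λ-COORDINATE IS DIFFERENTIABLE AT ALMOST EVERY COUPLING** (Lebesgue): Λ strictly antitone on ]0, e′] ⟹ for Lebesgue-a.e. `x ∈ ]0, e′[`, Λ is differentiable at x.
No hypothesis on B whatsoever beyond what part 35 proves. [folklore] -/
theorem ae_differentiableAt_abel (hanti : StrictAntiOn Λ (Ioc 0 e')) : ∀ᵐ x, x ∈ Ioo (0 : ℝ) e' → DifferentiableAt ℝ Λ x := by
  have hmono : MonotoneOn (fun x => -Λ x) (Ioc 0 e') := fun a ha b hb hab => neg_le_neg (hanti.antitoneOn ha hb hab)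
  filter_upwards [hmono.ae_differentiableWithinAt_of_mem] with x hx hxo
  have h1 : DifferentiableWithinAt ℝ (fun x => -Λ x) (Ioc 0 e') x := hx ⟨hxo.1, hxo.2.le⟩
  have h2 : DifferentiableAt ℝ (fun x => -Λ x) x := h1.differentiableAt (mem_of_superset (Ioo_mem_nhds hxo.1 hxo.2) Ioo_subset_Ioc_self)
  simpa using h2.neg

/-- The inverse coordinate `Λ⁻¹ := invFunOn Λ (Ioc 0 e′)` is strictly antitone on `[Λ e′, ∞[`. [folklore] -/
theorem abelInv_strictAntiOn (hanti : StrictAntiOn Λ (Ioc 0 e')) (honto : ∀ y : ℝ, Λ e' ≤ y → ∃ x ∈ Ioc (0 : ℝ) e', Λ x = y) :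
    StrictAntiOn (invFunOn Λ (Ioc 0 e')) (Ici (Λ e')) := by
  intro y hy y' hy' hyy'
  have m := invFunOn_mem (honto y hy)
  have e := invFunOn_eq (honto y hy)
  have m' := invFunOn_mem (honto y' hy')
  have e' := invFunOn_eq (honto y' hy')
  by_contra hle
  push Not at hle
  have := hanti.antitoneOn m m' hle
  rw [e, e'] at this
  exact absurd hyy' (not_lt.2 this)

/-- **THE INVERSE COORDINATE IS DIFFERENTIABLE AT ALMOST EVERY VALUE** (Lebesgue). [folklore] -/
theorem ae_differentiableAt_abelInv (hanti : StrictAntiOn Λ (Ioc 0 e')) (honto : ∀ y : ℝ, Λ e' ≤ y → ∃ x ∈ Ioc (0 : ℝ) e', Λ x = y) :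
    ∀ᵐ y, Λ e' < y → DifferentiableAt ℝ (invFunOn Λ (Ioc 0 e')) y := by
  have hmono : MonotoneOn (fun y => -invFunOn Λ (Ioc 0 e') y) (Ici (Λ e')) :=
    fun a ha b hb hab => neg_le_neg ((abelInv_strictAntiOn hanti honto).antitoneOn ha hb hab)
  filter_upwards [hmono.ae_differentiableWithinAt_of_mem] with y hy hyo
  have h1 : DifferentiableWithinAt ℝ (fun y => -invFunOn Λ (Ioc 0 e') y) (Ici (Λ e')) y := hy (mem_Ici.2 hyo.le)
  have h2 : DifferentiableAt ℝ (fun y => -invFunOn Λ (Ioc 0 e') y) y := h1.differentiableAt (Ici_mem_nhds hyo)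
  simpa using h2.neg

/-- **THE RUNNING COUPLING IS DIFFERENTIABLE AT ALMOST EVERY SCALE** (Lebesgue): for every `g ∈ ]0, e′]`, `s ↦ φ_s g` (strictly decreasing in s, part 46) is
differentiable at Lebesgue-almost every scale `s > 0`. [folklore] -/
theorem ae_differentiableAt_rg (hanti : StrictAntiOn Λ (Ioc 0 e')) (honto : ∀ y : ℝ, Λ e' ≤ y → ∃ x ∈ Ioc (0 : ℝ) e', Λ x = y) (hβ₀ : 0 < β₀)
    {g : ℝ} (hg : g ∈ Ioc (0 : ℝ) e') :
    ∀ᵐ s, s ∈ Ioi (0 : ℝ) → DifferentiableAt ℝ (fun σ : ℝ => invFunOn Λ (Ioc 0 e') (Λ g + σ * β₀)) s := by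
  have hsa : StrictAntiOn (fun σ : ℝ => invFunOn Λ (Ioc 0 e') (Λ g + σ * β₀)) (Ici 0) :=
    fun a ha b _ hab => rg_lt_rg_of_lt hanti honto hβ₀ hg ha hab
  have hmono : MonotoneOn (fun σ : ℝ => -invFunOn Λ (Ioc 0 e') (Λ g + σ * β₀)) (Ici 0) :=
    fun a ha b hb hab => neg_le_neg (hsa.antitoneOn ha hb hab)
  filter_upwards [hmono.ae_differentiableWithinAt_of_mem] with s hs hso
  have h1 := hs (mem_Ici.2 (le_of_lt hso))
  have h2 : DifferentiableAt ℝ (fun σ : ℝ => -invFunOn Λ (Ioc 0 e') (Λ g + σ * β₀)) s := h1.differentiableAt (Ici_mem_nhds hso)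
  simpa using h2.neg

/-! ## §87 Continuity, and bounds on the derivative where it exists -/

/-- Λ is continuous at every interior coupling (the two-sided chart bounds squeeze it). [folklore] -/
theorem abel_continuousAt (hbounds : ∀ e₁ ∈ Ioc (0 : ℝ) e', ∀ e₂ ∈ Ioc (0 : ℝ) e', e₁ ≤ e₂ →
      2 / 3 * (1 / e₁ ^ 2 - 1 / e₂ ^ 2) ≤ Λ e₁ - Λ e₂ ∧ Λ e₁ - Λ e₂ ≤ 4 / 3 * (1 / e₁ ^ 2 - 1 / e₂ ^ 2))
    {x : ℝ} (hx : x ∈ Ioo (0 : ℝ) e') : ContinuousAt Λ x := by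
  -- `|Λ y − Λ x| ≤ (4∕3)|1∕y² − 1∕x²|` near x, and the chart is continuous at x
  have hchart : ContinuousAt (fun y : ℝ => 1 / y ^ 2) x := by
    have : ContinuousAt (fun y : ℝ => y ^ 2) x := (continuous_pow 2).continuousAt
    exact continuousAt_const.div this (pow_ne_zero 2 hx.1.ne')
  rw [Metric.continuousAt_iff] at hchart ⊢
  intro ε hε
  obtain ⟨δ, hδ, hδ'⟩ := hchart (ε / 2) (by linarith)
  refine ⟨min δ (min x (e' - x)), lt_min hδ (lt_min hx.1 (by linarith [hx.2])), fun y hy => ?_⟩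
  have hyδ : dist y x < δ := lt_of_lt_of_le hy (min_le_left _ _)
  have hy1 : dist y x < x := lt_of_lt_of_le hy ((min_le_right _ _).trans (min_le_left _ _))
  have hy2 : dist y x < e' - x := lt_of_lt_of_le hy ((min_le_right _ _).trans (min_le_right _ _))
  rw [Real.dist_eq] at hy1 hy2
  have hymem : y ∈ Ioc (0 : ℝ) e' := ⟨by linarith [abs_lt.1 hy1], by linarith [abs_lt.1 hy2]⟩
  have hxmem : x ∈ Ioc (0 : ℝ) e' := ⟨hx.1, hx.2.le⟩
  have hc := hδ' hyδ
  rw [Real.dist_eq] at hc ⊢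
  have key : |Λ y - Λ x| ≤ 4 / 3 * |1 / y ^ 2 - 1 / x ^ 2| := by
    rcases le_total y x with hyx | hxy
    · obtain ⟨h1, h2⟩ := hbounds y hymem x hxmem hyx
      have hnn : 0 ≤ 1 / y ^ 2 - 1 / x ^ 2 := by nlinarith
      rw [abs_of_nonneg (by linarith), abs_of_nonneg hnn]
      exact h2
    · obtain ⟨h1, h2⟩ := hbounds x hxmem y hymem hxy
      have hnn : 0 ≤ 1 / x ^ 2 - 1 / y ^ 2 := by nlinarith
      rw [abs_sub_comm, abs_of_nonneg (by linarith), abs_sub_comm, abs_of_nonneg hnn]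
      exact h2
  calc |Λ y - Λ x| ≤ 4 / 3 * |1 / y ^ 2 - 1 / x ^ 2| := key
    _ < 4 / 3 * (ε / 2) := by nlinarith
    _ ≤ ε := by linarith

/-- **BOUNDS ON THE DERIVATIVE OF THE Λ-COORDINATE WHERE IT EXISTS**: with part 35's chart bounds (2∕3, 4∕3), at every interior coupling x where Λ has a derivative D:
**`−8∕(3x³) ≤ D ≤ −4∕(3x³)`** — in particular `D < 0`. [folklore] -/
theorem hasDerivAt_abel_bounds (hbounds : ∀ e₁ ∈ Ioc (0 : ℝ) e', ∀ e₂ ∈ Ioc (0 : ℝ) e', e₁ ≤ e₂ →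
      2 / 3 * (1 / e₁ ^ 2 - 1 / e₂ ^ 2) ≤ Λ e₁ - Λ e₂ ∧ Λ e₁ - Λ e₂ ≤ 4 / 3 * (1 / e₁ ^ 2 - 1 / e₂ ^ 2))
    {x D : ℝ} (hx : x ∈ Ioo (0 : ℝ) e') (hD : HasDerivAt Λ D x) : -8 / (3 * x ^ 3) ≤ D ∧ D ≤ -4 / (3 * x ^ 3) ∧ D < 0 := by
  have hxmem : x ∈ Ioc (0 : ℝ) e' := ⟨hx.1, hx.2.le⟩
  have hratio : ∀ᶠ y in 𝓝[<] x, 2 / 3 * (1 / y ^ 2 - 1 / x ^ 2) ≤ Λ y - Λ x ∧ Λ y - Λ x ≤ 4 / 3 * (1 / y ^ 2 - 1 / x ^ 2) := by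
    have hIoo : Ioo 0 x ∈ 𝓝[<] x := Ioo_mem_nhdsLT hx.1
    filter_upwards [hIoo] with y hy
    exact hbounds y ⟨hy.1, hy.2.le.trans hx.2.le⟩ x hxmem hy.2.le
  obtain ⟨h1, h2⟩ := hasDerivAt_chart_bounds_left hx.1 hD hratio
  have hx3 : 0 < x ^ 3 := pow_pos hx.1 3
  refine ⟨?_, ?_, ?_⟩
  · calc -8 / (3 * x ^ 3) = -2 * (4 / 3) / x ^ 3 := by field_simp; ring
      _ ≤ D := h1
  · calc D ≤ -2 * (2 / 3) / x ^ 3 := h2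
      _ = -4 / (3 * x ^ 3) := by field_simp; ring
  · calc D ≤ -2 * (2 / 3) / x ^ 3 := h2
      _ < 0 := by apply div_neg_of_neg_of_pos (by norm_num) hx3

/-- The inverse coordinate is continuous at every value above `Λ e′` (part 51's continuity in the scale, read through `Λ⁻¹ y = φ_{(y − Λ e′)∕β₀}(e′)`). [folklore] -/
theorem abelInv_continuousAt (hanti : StrictAntiOn Λ (Ioc 0 e')) (honto : ∀ y : ℝ, Λ e' ≤ y → ∃ x ∈ Ioc (0 : ℝ) e', Λ x = y) (hβ₀ : 0 < β₀)
    (hlo : ∀ e₁ ∈ Ioc (0 : ℝ) e', ∀ e₂ ∈ Ioc (0 : ℝ) e', e₁ ≤ e₂ → 2 / 3 * (1 / e₁ ^ 2 - 1 / e₂ ^ 2) ≤ Λ e₁ - Λ e₂)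
    {y : ℝ} (hy : Λ e' < y) : ContinuousAt (invFunOn Λ (Ioc 0 e')) y := by
  obtain ⟨x, hx, -⟩ := honto y hy.le
  have he' : e' ∈ Ioc (0 : ℝ) e' := ⟨hx.1.trans_le hx.2, le_rfl⟩
  have hF := rg_continuousOn hanti honto hβ₀ hlo he'
  have hs0 : 0 < (y - Λ e') / β₀ := div_pos (by linarith) hβ₀
  have h1 : ContinuousAt (fun s : ℝ => invFunOn Λ (Ioc 0 e') (Λ e' + s * β₀)) ((y - Λ e') / β₀) := hF.continuousAt (Ici_mem_nhds hs0)
  have h2 : ContinuousAt (fun z : ℝ => (z - Λ e') / β₀) y := ((continuous_id.sub continuous_const).div_const _).continuousAt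
  have h3 : ContinuousAt ((fun s : ℝ => invFunOn Λ (Ioc 0 e') (Λ e' + s * β₀)) ∘ fun z : ℝ => (z - Λ e') / β₀) y := ContinuousAt.comp h1 h2
  have heq : ((fun s : ℝ => invFunOn Λ (Ioc 0 e') (Λ e' + s * β₀)) ∘ fun z : ℝ => (z - Λ e') / β₀) = invFunOn Λ (Ioc 0 e') := by
    funext z
    simp only [Function.comp]
    rw [div_mul_cancel₀ _ hβ₀.ne', show Λ e' + (z - Λ e') = z by ring]
  rwa [heq] at h3

/-- **THE INVERSE COORDINATE IS DIFFERENTIABLE WHERE Λ IS**, with the reciprocal derivative: Λ differentiable at the interior coupling x with derivative D (then `D < 0`)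
⟹ `Λ⁻¹` has derivative `D⁻¹` at `Λ x`. [folklore] -/
theorem hasDerivAt_abelInv (hanti : StrictAntiOn Λ (Ioc 0 e')) (honto : ∀ y : ℝ, Λ e' ≤ y → ∃ x ∈ Ioc (0 : ℝ) e', Λ x = y) (hβ₀ : 0 < β₀)
    (hbounds : ∀ e₁ ∈ Ioc (0 : ℝ) e', ∀ e₂ ∈ Ioc (0 : ℝ) e', e₁ ≤ e₂ →
      2 / 3 * (1 / e₁ ^ 2 - 1 / e₂ ^ 2) ≤ Λ e₁ - Λ e₂ ∧ Λ e₁ - Λ e₂ ≤ 4 / 3 * (1 / e₁ ^ 2 - 1 / e₂ ^ 2))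
    {x D : ℝ} (hx : x ∈ Ioo (0 : ℝ) e') (hD : HasDerivAt Λ D x) : HasDerivAt (invFunOn Λ (Ioc 0 e')) D⁻¹ (Λ x) := by
  have hxmem : x ∈ Ioc (0 : ℝ) e' := ⟨hx.1, hx.2.le⟩
  have he' : e' ∈ Ioc (0 : ℝ) e' := ⟨hx.1.trans hx.2, le_rfl⟩
  have hΛx : Λ e' < Λ x := hanti hxmem he' hx.2
  have hDne : D ≠ 0 := (hasDerivAt_abel_bounds hbounds hx hD).2.2.ne
  have hleft : invFunOn Λ (Ioc 0 e') (Λ x) = x := hanti.injOn.leftInvOn_invFunOn hxmem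
  have hcont : ContinuousAt (invFunOn Λ (Ioc 0 e')) (Λ x) :=
    abelInv_continuousAt hanti honto hβ₀ (fun e₁ h₁ e₂ h₂ h => (hbounds e₁ h₁ e₂ h₂ h).1) hΛx
  have hD' : HasDerivAt Λ D (invFunOn Λ (Ioc 0 e') (Λ x)) := by rw [hleft]; exact hD
  have hfg : ∀ᶠ y in 𝓝 (Λ x), Λ (invFunOn Λ (Ioc 0 e') y) = y := by
    filter_upwards [Ici_mem_nhds hΛx] with y hy
    exact invFunOn_eq (honto y hy)
  exact hD'.of_local_left_inverse hcont hDne hfg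

end

end Summit.QuantumFields.BalabanUV.Beta.EriceFlowEnclosureB12AsPrintedHistoryContagionShiftFlowZeroSemigroupVelocity
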